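import Literature.NumberTheory.Sieve.Maynard2016Lemma93EulerProduct
import HarnessLib

/-!
# Maynard 2016, proof of Lemma 9.3 — the local census of the Euler factor (displays (9.27)–(9.28))

Sources: J. Maynard, *Dense clusters of primes in subsets*, Compositio Math. 152 (2016) 1517–1554 =
arXiv:1405.2593 [Maynard2016DenseClusters], proof of Lemma 9.3, p. 24 (displays (9.27)–(9.28): «there are
`ω_𝓛(p) − 1` such indices…»); K. Ford, B. Green, S. Konyagin, J. Maynard, T. Tao, *Long gaps between
primes*, JAMS 31 (2018) [FordGreenKonyaginMaynardTao2018], §7 (7.8) and Theorem 6 (7.13).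

The Euler factor `FGKMT2018.eulerFactorM` of `Maynard2016Lemma93EulerProduct` for the weight of (9.25),
`w_p(j) = S'^{(m)}_p(j)/(p − ω(p))`, is evaluated by counting admissible indices (the census behind (9.27)):
among `j ∈ admIdx(p) ∖ {m}` there are `#admIdxM = ω(p) − [p ∤ a_m]` indices with `p ∤ a_j b_m − a_m b_j`
(`FGKMT2018.card_admIdxM_add`), where `S' = 0` if `p ∣ a_m` and `S' = −1/(p−1)` otherwise
(`FGKMT2018.sPrimeM_of_not`), and `[p ∤ a_m]·[m ∉ admIdx(p)]` indices with `p ∣ a_j b_m − a_m b_j`, where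
`S' = 1` (`card_deltaIdx_add`). Hence (`sum_erase_sPrimeM_eq`, `eulerFactorM_sPrime`), for `p ∤ WB·M`:
`Λ_p = 1` if `p ∣ a_m`, and otherwise
`Λ_p = 1 − (ω(p) − 1)/((p − 1)(p − ω(p))) + [m ∉ admIdx(p)]/(p − ω(p))`, whose first part is the factor
`p/(p−1) − 1/(p − ω(p))` of `MaynardDense.emEuler` (`one_sub_div_eq_emFactor`) — Maynard's
`1 − (ω−1)/((p−1)(p−ω))` of display (9.27) (in (9.27)–(9.28) the text takes `m ∈ admIdx(p)` for all `p`,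
which holds for `p ∤ a_m B`; the extra term records the general case).

## References
* J. Maynard, *Dense clusters of primes in subsets*, Compositio Math. 152 (2016), proof of Lemma 9.3
  p. 24, (9.27)–(9.28) [Maynard2016DenseClusters].
* K. Ford, B. Green, S. Konyagin, J. Maynard, T. Tao, *Long gaps between primes*, JAMS 31 (2018), §7 (7.8),
  Thm 6 (7.13) [FordGreenKonyaginMaynardTao2018].
-/

noncomputable section

open Finset
open scoped Nat

namespace Literature.NumberTheory.Sieve

namespace FGKMT2018

variable {k : ℕ}

/-- `S'^{(m)}_p(j) = 1` when `p ∣ a_j b_m − a_m b_j`. [cite: Maynard2016DenseClusters, proof of Lemma 9.3 p. 23, (9.24)] -/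
theorem sPrimeM_of_dvd_crossDet (L : Fin k → ℤ × ℤ) (m j : Fin k) {p : ℕ}
    (h : p ∣ (crossDet L m j).natAbs) : sPrimeM L m j p = 1 := by
  unfold sPrimeM; rw [if_pos (Or.inr h)]

/-- `admIdxM` is the part of `admIdx(p) ∖ {m}` with `p ∤ a_j b_m − a_m b_j`.
[cite: Maynard2016DenseClusters, proof of Lemma 9.3 p. 24, (9.27)] -/
theorem filter_erase_admIdx_not_dvd (L : Fin k → ℤ × ℤ) (m : Fin k) (p : ℕ) :
    ((admIdx L p).erase m).filter (fun j => ¬ p ∣ (crossDet L m j).natAbs) = admIdxM L m p := by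
  ext j
  rw [Finset.mem_filter, Finset.mem_erase, mem_admIdxM]
  tauto

/-- **Census of the `Δ`-indices**: `#{j ∈ admIdx(p) ∖ {m} : p ∣ a_j b_m − a_m b_j} + [m ∈ admIdx(p)] = [p ∤ a_m]`.
[cite: Maynard2016DenseClusters, proof of Lemma 9.3 p. 24, (9.27)–(9.28) (index counts)] -/
theorem card_deltaIdx_add {L : Fin k → ℤ × ℤ} (hadm : FormsAdmissible L) (m : Fin k) {p : ℕ}
    (hp : p.Prime) :
    #(((admIdx L p).erase m).filter (fun j => p ∣ (crossDet L m j).natAbs)) +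
        (if m ∈ admIdx L p then 1 else 0) = if p ∣ (L m).1.natAbs then 0 else 1 := by
  classical
  have h1 := card_admIdxM_add hadm m hp
  have h2 : #(((admIdx L p).erase m).filter (fun j => p ∣ (crossDet L m j).natAbs)) +
      #(admIdxM L m p) = #((admIdx L p).erase m) := by
    rw [← filter_erase_admIdx_not_dvd L m p, Finset.card_filter_add_card_filter_not]
  have h3 : #((admIdx L p).erase m) + (if m ∈ admIdx L p then 1 else 0) = #(admIdx L p) := by
    split_ifs with hm
    · exact Finset.card_erase_add_one hm
    · rw [Finset.erase_eq_of_notMem hm, add_zero]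
  have h4 := card_admIdx hadm hp
  split_ifs at h1 h3 ⊢ <;> omega

/-- **The index sum of the local factors**:
`∑_{j ∈ admIdx(p) ∖ {m}} S'^{(m)}_p(j) = 0` if `p ∣ a_m`, and
`= −(ω(p) − 1)/(p − 1) + [m ∉ admIdx(p)]` if `p ∤ a_m`.
[cite: Maynard2016DenseClusters, proof of Lemma 9.3 p. 24, (9.27) («there are ω_𝓛(p) − 1 such indices»)] -/
theorem sum_erase_sPrimeM_eq {L : Fin k → ℤ × ℤ} (hadm : FormsAdmissible L) (m : Fin k) {p : ℕ}
    (hp : p.Prime) :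
    ∑ j ∈ (admIdx L p).erase m, sPrimeM L m j p =
      if p ∣ (L m).1.natAbs then 0
      else -((omegaL L p : ℝ) - 1) / ((p : ℝ) - 1) + (if m ∈ admIdx L p then 0 else 1) := by
  classical
  have hl : (L m).1 ≠ 0 := hadm.1 m
  have hcount := card_deltaIdx_add hadm m hp
  have hcardA := card_admIdxM_add hadm m hp
  set Km := ((admIdx L p).erase m).filter (fun j => p ∣ (crossDet L m j).natAbs) with hKm
  have hsplit : ∑ j ∈ (admIdx L p).erase m, sPrimeM L m j p =
      ∑ j ∈ Km, sPrimeM L m j p + ∑ j ∈ admIdxM L m p, sPrimeM L m j p := by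
    rw [← filter_erase_admIdx_not_dvd L m p, hKm, Finset.sum_filter_add_sum_filter_not]
  have hK : ∑ j ∈ Km, sPrimeM L m j p = #Km := by
    rw [Finset.card_eq_sum_ones, Nat.cast_sum, Nat.cast_one]
    exact Finset.sum_congr rfl fun j hj => sPrimeM_of_dvd_crossDet L m j (Finset.mem_filter.1 hj).2
  have hA : ∑ j ∈ admIdxM L m p, sPrimeM L m j p =
      #(admIdxM L m p) * (if p ∣ (L m).1.natAbs then 0 else -1 / ((p : ℝ) - 1)) := by
    rw [Finset.card_eq_sum_ones, Nat.cast_sum, Finset.sum_mul, Nat.cast_one, one_mul]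
    refine Finset.sum_congr rfl fun j hj => ?_
    obtain ⟨-, hjm, hΔ⟩ := mem_admIdxM.1 hj
    exact sPrimeM_of_not L hl hp (not_or.2 ⟨hjm, hΔ⟩)
  rw [hsplit, hK, hA]
  by_cases hpa : p ∣ (L m).1.natAbs
  · rw [if_pos hpa] at hcount hcardA ⊢
    have hKm0 : #Km = 0 := by
      have : #Km + (if m ∈ admIdx L p then 1 else 0) = 0 := hcount
      split_ifs at this; omega
    rw [if_pos hpa, hKm0, Nat.cast_zero, mul_zero, add_zero]
  · rw [if_neg hpa] at hcount hcardA ⊢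
    rw [if_neg hpa]
    have hAc : (#(admIdxM L m p) : ℝ) = (omegaL L p : ℝ) - 1 := by
      have h := congrArg (fun n : ℕ => (n : ℝ)) hcardA
      simp only [Nat.cast_add, Nat.cast_one] at h
      linarith
    have hKc : (#Km : ℝ) = if m ∈ admIdx L p then 0 else 1 := by
      split_ifs at hcount ⊢ with hm
      · have : #Km = 0 := by omega
        rw [this, Nat.cast_zero]
      · have : #Km = 1 := by omega
        rw [this, Nat.cast_one]
    rw [hKc, hAc]
    ring

/-- The algebra of display (9.27): `1 − (ω − 1)/((p − 1)(p − ω)) = p/(p − 1) − 1/(p − ω)` — the factor of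
`MaynardDense.emEuler`. [cite: Maynard2016DenseClusters, proof of Lemma 9.3 p. 24, (9.27)] -/
theorem one_sub_div_eq_emFactor {p ω : ℝ} (hp1 : p - 1 ≠ 0) (hpω : p - ω ≠ 0) :
    1 - (ω - 1) / ((p - 1) * (p - ω)) = p / (p - 1) - 1 / (p - ω) := by
  field_simp
  ring

/-- **The Euler factor of (9.27) for the weight of (9.25)** (`w_p(j) = S'^{(m)}_p(j)/(p − ω(p))`):
for `p ∤ WB`, `p ∤ M`: `Λ_p = 1` if `p ∣ a_m`, else
`Λ_p = 1 − (ω(p) − 1)/((p − 1)(p − ω(p))) + [m ∉ admIdx(p)]/(p − ω(p))`; and `Λ_p = 1` for `p ∣ WB·M`.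
[cite: Maynard2016DenseClusters, proof of Lemma 9.3 p. 24, (9.27)–(9.28)] -/
theorem eulerFactorM_sPrime {L : Fin k → ℤ × ℤ} (hadm : FormsAdmissible L) (B : ℕ) (m : Fin k)
    (M : ℕ) {p : ℕ} (hp : p.Prime) :
    eulerFactorM L B m M (fun p j => sPrimeM L m j p / ((p : ℝ) - omegaL L p)) p =
      if p.Coprime (wCut k B * B) ∧ ¬ p ∣ M then
        (if p ∣ (L m).1.natAbs then 1
         else 1 - ((omegaL L p : ℝ) - 1) / (((p : ℝ) - 1) * ((p : ℝ) - omegaL L p)) +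
           (if m ∈ admIdx L p then 0 else 1) / ((p : ℝ) - omegaL L p))
      else 1 := by
  have hωlt : omegaL L p < p := ((formsAdmissible_iff_omegaL L).1 hadm).2 p hp
  have hpω : ((p : ℝ) - omegaL L p) ≠ 0 := by
    have : (omegaL L p : ℝ) < p := by exact_mod_cast hωlt
    linarith
  have hp1 : ((p : ℝ) - 1) ≠ 0 := by
    have : (1 : ℝ) < p := by exact_mod_cast hp.one_lt
    linarith
  unfold eulerFactorM
  by_cases hc : p.Coprime (wCut k B * B) ∧ ¬ p ∣ M
  · rw [if_pos hc, if_pos hc, ← Finset.sum_div, sum_erase_sPrimeM_eq hadm m hp]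
    by_cases hpa : p ∣ (L m).1.natAbs
    · rw [if_pos hpa, if_pos hpa, zero_div, add_zero]
    · rw [if_neg hpa, if_neg hpa]
      generalize (if m ∈ admIdx L p then (0 : ℝ) else 1) = ι
      field_simp
      ring
  · rw [if_neg hc, if_neg hc, add_zero]

end FGKMT2018

end Literature.NumberTheory.Sieve
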